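import Summits.QuantumFields.YangMills.Theorems.LuscherReductionTwistedTraceScalingBOLocalisedAvgChartLower
import Summits.QuantumFields.YangMills.Theorems.LuscherReductionTwistedTraceScalingBOSliceSlowMean
import HarnessLib

/-!
# (C1c'-ξ') THE LOWER GAUSSIAN BOUND WITH THE SHARP WINDOW FLOOR — hAlo of the (C1) glue for a smearing window of size `O(KLβ^{-1/2}ℓ²)`
# (lane A of S-BASE, crux `TwistedTraceScaling` stmt-QuantumFields-20203, C4-CORE, the (OD) pen; repair recorded in `pub/ym-fleet/ym-luscher-20007-p1/HANDOFF-g18.md`)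

`…BOLocalisedAvgChartLower.localisedAvg_chart_lower` asks the window floor `χ_lo ≤ χ₀` on the CRUDE window `‖q(u_k) − 1‖ ≤ 5MKβ^{-s}` (five fat LINK radii), which is incompatible with the
support requirement `supp boFun χ₀ Ω ⊆ supp recordChi` (orbit cut-off `Kβ^{-s}`, i.e. `δu ≲ Kβ^{-s}/L³`): with that hypothesis only `χ_lo = 0` is available and the lower bound is empty.
★★★ `localisedAvg_chart_lower_sharp` — the same statement and proof with the floor asked only on the SHARP window `a_W = 2(4+48K)ρ + 6(40(4r² + 2r(4+48K)ρ) + 3r)` of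
`…BOSliceSlowMean.slowMean_slice_core_sharp` (slow displacement of the representative + second-order gauge term).  On schedule B `a_W = O(KLβ^{-1/2}ℓ²)`, so the smearing window
`δu = β^{-s'}`, `s' < 1/2`, satisfies both the floor and — with an auxiliary fat tube of orbit radius `β^{-s''}`, `s'' < s'` — the support inclusion.
HONEST FRAMING: assembly for a stub of a child of the CONDITIONAL route R2b1; (C1) packaging/rates, (C4), (C5), (B-ST) OPEN; C4-CORE OPEN; not infinite volume, not a gap, not Clay.
-/

set_option autoImplicit false

noncomputable section

open MeasureTheory Real
open scoped BigOperators RealInnerProductSpace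
open Literature.MathematicalPhysics.QuantumFieldTheory
open Literature.MathematicalPhysics.QuantumLattice

namespace Summit.QuantumFields.YangMills.Theorems.FemtoTransferGap.TwoLattice.ConstTube

open Summit.QuantumFields.YangMills.Theorems.FemtoTransferGap
open Summit.QuantumFields.YangMills.Theorems.FemtoTransferGap.TwoLattice
open Summit.QuantumFields.YangMills.Theorems.FemtoTransferGap.TwoLattice.Avg
open Summit.QuantumFields.YangMills.Theorems.FemtoTransferGap.TwoLattice.Stiff
open Summit.QuantumFields.YangMills.Theorems.FemtoTransferGap.TwoLattice.GnChart
open Literature.MathematicalPhysics.QuantumFieldTheory.Balaban1983to89.T4CubeChartGnomonic (gnoPoint)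

variable {L : ℕ} [NeZero L]

set_option maxHeartbeats 400000 in
/-- ★★★ **(C1c') LOWER HALF WITH THE SHARP WINDOW FLOOR.**  As `…BOLocalisedAvgChartLower.localisedAvg_chart_lower`, but the window floor `χ_lo ≤ χ₀(u)` is required only for one-site
configurations with `‖q(u_k) − 1‖ ≤ a_W`, `S₁(u) ≤ 12a_W⁴`, `a_W = 2(4+48K)ρ + 6(40(4r² + 2r(4+48K)ρ) + 3r)` (the SHARP slow-mean fact `…BOSliceSlowMean.slowMean_slice_core_sharp`; needs
`r ≤ 1/40`) — a window of size `O(KLβ^{-1/2}ℓ²)`, compatible with the orbit cut-off of an auxiliary fat tube.  Other hypotheses: those of `localisedAvg_chart_upper`, (P) from below, the profile radius `R_w + (7|E|ρ + 9BK_{sp}ρ + M_T(9K_{sp}ρ)²) + (Br + M_Tr²) ≤ r_f β`, the step-(5) conditions of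
`…BOCoreComplement.integral_coreComplement_eq_zero` (based radius `3(L−1)(ρ₁ + Mδ) ≤ 1/3`, jump radius `32C_L(R_w + 14|E|ρ² + r_f β) < R₁'` — the core-complement part VANISHES), and
`T_b ≤ N_lo`.  Then `Z·χ_lo·e^{−(ε_q+ε_tr)}·(N_lo − T_b)·e^{−q_{t,b}(chartVec w)} ≤ A(P w)`. [cite: Luscher1983, §3] -/
theorem localisedAvg_chart_lower_sharp (hL : Nonempty (NzSite L)) {s K M : ℝ} {β : ℝ} (hs1 : 0 < powScale 1 β)
    -- the toolchain
    {Ksp εsp : ℝ} (hKsp : 0 ≤ Ksp)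
    (hSP : ∀ w : Edge 3 L → Fin 3 → ℝ, w ∈ balancedSet L → ∀ c : Fin 3 → Fin 3 → ℝ, ‖w‖ < εsp → ‖c‖ < εsp →
      ∃ ξ : Site 3 L → Fin 3 → ℝ, ∑ x : Site 3 L, ξ x = 0 ∧ ‖ξ‖ ≤ Ksp * ‖w‖ ∧
        gaugeCoordSq L (gaugeTransform (fun x => chartSU2 (ξ x)) (orthoTube L (fun e₁ => chartSU2 (c e₁.2)) w)) = 0)
    {εT MT : ℝ} (hMT : 0 ≤ MT) (hεT : 0 < εT)
    (hT : ∀ (ξ : basedSubmodule L) (q : balancedSubmodule L × (Fin 3 → Fin 3 → ℝ)), ‖ξ‖ < εT → ‖q‖ < εT →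
      ‖basedFn L (ξ, q) - basedFn L (0, q) - basedLin L q ξ‖ ≤ MT * ‖ξ‖ ^ 2)
    {εC : ℝ} (hC : ∀ q : balancedSubmodule L × (Fin 3 → Fin 3 → ℝ), ‖q‖ < εC →
      ∀ ξ : basedSubmodule L, ‖ξ‖ ≤ 4 * sliceConst L * ‖(gaugeModes L).starProjection (basedLin L q ξ)‖)
    {εI : ℝ} (hI : ∀ q : balancedSubmodule L × (Fin 3 → Fin 3 → ℝ), ‖q‖ < εI → ∀ {a s' : ℝ}, 0 < a → 0 < s' →
      ∫ w, Real.exp (-(a * ‖laplaceMap L q w‖ ^ 2 / s' ^ 2)) ∂(volume : Measure (NzSite L → Fin 3 → ℝ)) =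
        (π * s' ^ 2 / a) ^ (flatDim L / 2 : ℝ) / Real.sqrt (gramDet L q))
    {KD εD : ℝ} (hKD : 0 ≤ KD) (hD : ∀ q : balancedSubmodule L × (Fin 3 → Fin 3 → ℝ), ‖q‖ < εD → |gramDet L q / gramDet L 0 - 1| ≤ KD * ‖q‖ ^ 2)
    {B εB : ℝ} (hB0 : 0 ≤ B) (hB : ∀ q : balancedSubmodule L × (Fin 3 → Fin 3 → ℝ), ‖q‖ < εB → ‖basedLin L q‖ ≤ B)
    {CL εL : ℝ} (hCL : 0 ≤ CL)
    (hLip : ∀ q : balancedSubmodule L × (Fin 3 → Fin 3 → ℝ), ‖q‖ < εL → ∀ ξ : basedSubmodule L, ‖(basedLin L q - basedLin L 0) ξ‖ ≤ CL * ‖q‖ * ‖ξ‖)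
    -- the profile, the amplitude, the weight
    {t b : ℝ} (ht : 0 ≤ t) (hb : 0 ≤ b) {qf : ℝ → LinkSpace L → ℝ} (hqfm : ∀ β', Measurable (qf β')) (hqf0 : ∀ β' x, 0 ≤ qf β' x)
    (hqfinv : ∀ β' (g : SU2) (x : LinkSpace L), qf β' (adL L g x) = qf β' x) (hqf : qf β = stiffGaussExp L t b) {rf : ℝ → ℝ}
    {χ₀ : GaugeConfig 3 1 SU2 → ℝ} (hχm : Measurable χ₀) {Cχ : ℝ} (hχ0 : ∀ u, 0 ≤ χ₀ u) (hCχ : ∀ u, χ₀ u ≤ Cχ)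
    (hχinv : ∀ (c : SU2) (u : GaugeConfig 3 1 SU2), χ₀ (gaugeTransform (fun _ : Site 3 1 => c) u) = χ₀ u)
    (hbo : ∀ U, boFun L χ₀ (frozenProfile L qf rf β) U ≠ 0 → recordChi L s K M β U ≠ 0)
    (ε R₁' : ℝ) {Z : ℝ} (hZ0 : 0 ≤ Z) (hZ : ∀ g : Site 3 L → SU2, ∫ c, fpWeight L ε (fun x => c * g x) ∂haarProbability SU2 = Z)
    -- (P): the Faddeev–Popov weight on the fat tube, from below
    {Nlo : ℝ} (hN : ∀ U ∈ fatTubeRho L (fun b' => K * powScale s b') (fun b' => M * (K * powScale s b')) β, Nlo ≤ gaugeAvg (recordChi L s K M β) U)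
    -- radii and their smallness
    {ρ r R₁ ρ₁ : ℝ} (hρ0 : 0 ≤ ρ) (hρ5 : ρ ≤ 1 / 5) (hρε : 3 * ρ < εsp) (hρK : 3 * Ksp * ρ ≤ 1 / 8) (hR50 : ((2 + 24 * Ksp) * ρ) ^ 2 / 4 ≤ 1 / 50)
    (h1 : (4 + 48 * Ksp) * ρ < εT) (h2 : (4 + 48 * Ksp) * ρ < εL) (h3 : (4 + 48 * Ksp) * ρ < εB) (h4 : (4 + 48 * Ksp) * ρ ≤ 1 / 40) (h5 : 9 * Ksp * ρ < εT)
    (h6 : (4 + 48 * Ksp) * ρ < εC) (h7 : (4 + 48 * Ksp) * ρ < εI) (h8 : (4 + 48 * Ksp) * ρ < εD) (h9 : KD * ((4 + 48 * Ksp) * ρ) ^ 2 ≤ 1 / 2)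
    (hδ : Real.sqrt 2 * Fintype.card (Edge 3 L) * ρ < K * powScale s β) (hρf : Real.sqrt 2 * ρ < M * (K * powScale s β)) (hρ₁ : (2 + 24 * Ksp) * ρ < ρ₁)
    (hr0 : 0 ≤ r) (hrR : r ≤ R₁) (hR1 : R₁ ≤ 1 / 2) (hR1T : R₁ < εT) (hcore : ρ₁ + 8 * r ≤ M * (K * powScale s β))
    (hsupp : 3 * ((L : ℝ) - 1) * (ρ₁ + M * (K * powScale s β)) ≤ R₁) (hθ : (MT + 2 * B) * R₁ * (4 * sliceConst L) ≤ 1 / 4)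
    (hρ4 : M * (K * powScale s β) ≤ 1 / 4)
    -- the window floor, the profile radius, the chart point, the core-complement tail
    {χlo : ℝ} (hχlo0 : 0 ≤ χlo) (hr40 : r ≤ 1 / 40)
    (hχlo : ∀ u : GaugeConfig 3 1 SU2,
      (∀ k : Fin 3, ‖su2Quat (u (0, k)) - 1‖ ≤ 2 * ((4 + 48 * Ksp) * ρ) + 6 * (40 * (4 * r ^ 2 + 2 * r * ((4 + 48 * Ksp) * ρ)) + 3 * r)) →
      wilsonAction su2Rep u ≤ 12 * (2 * ((4 + 48 * Ksp) * ρ) + 6 * (40 * (4 * r ^ 2 + 2 * r * ((4 + 48 * Ksp) * ρ)) + 3 * r)) ^ 4 → χlo ≤ χ₀ u)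
    {Rw : ℝ} (hrf : Rw + 14 * Fintype.card (Edge 3 L) * ρ ^ 2 + (CL * ((4 + 48 * Ksp) * ρ) * (9 * Ksp * ρ) + MT * (9 * Ksp * ρ) ^ 2) + (B * r + MT * r ^ 2) ≤ rf β)
    {w : Edge 3 L → Fin 3 → ℝ} (hw : ∀ e, ∑ a, w e a ^ 2 ≤ ρ ^ 2) (hcwR : ‖chartVec w‖ ≤ Rw)
    -- step (5): the based radius and the jump radius of the Faddeev–Popov core
    (ha'3 : 9 * Ksp * ρ ≤ 1 / 3) (hboot' : 4 * sliceConst L * MT * (9 * Ksp * ρ) ≤ 1 / 2)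
    (hRb3 : 3 * ((L : ℝ) - 1) * (ρ₁ + M * (K * powScale s β)) ≤ 1 / 3) (hRbT : 3 * ((L : ℝ) - 1) * (ρ₁ + M * (K * powScale s β)) < εT)
    (hbootb : 4 * sliceConst L * MT * (3 * ((L : ℝ) - 1) * (ρ₁ + M * (K * powScale s β))) ≤ 1 / 2)
    (hjump : 32 * sliceConst L * ((Rw + 14 * Fintype.card (Edge 3 L) * ρ ^ 2) + rf β) < R₁')
    (hNT : (1 + KD * ((4 + 48 * Ksp) * ρ) ^ 2) * (4 : ℝ) ^ (flatDim L / 2 : ℝ) * Real.exp (-((1 / (4 * sliceConst L)) ^ 2 * r ^ 2 / (4 * powScale 1 β ^ 2))) *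
      fpWeightBar L (powScale 1 β) ≤ Nlo) :
    Z * (χlo * Real.exp (-(((96 * t + b) * (B * r + MT * r ^ 2) * (2 * (Rw + 14 * ((Fintype.card (Edge 3 L) : ℝ)) * ρ ^ 2 + (CL * ((4 + 48 * Ksp) * ρ) * (9 * Ksp * ρ) + MT * (9 * Ksp * ρ) ^ 2)) + (B * r + MT * r ^ 2))) + ((96 * t + b) * ((CL * ((4 + 48 * Ksp) * ρ) * (9 * Ksp * ρ) + MT * (9 * Ksp * ρ) ^ 2) * (2 * (Rw + 14 * ((Fintype.card (Edge 3 L) : ℝ)) * ρ ^ 2 + (CL * ((4 + 48 * Ksp) * ρ) * (9 * Ksp * ρ) + MT * (9 * Ksp * ρ) ^ 2)) + (CL * ((4 + 48 * Ksp) * ρ) * (9 * Ksp * ρ) + MT * (9 * Ksp * ρ) ^ 2)) + 72 * ((Fintype.card (Edge 3 L) : ℝ)) * ρ ^ 3)))) * (Nlo - ((1 + KD * ((4 + 48 * Ksp) * ρ) ^ 2) * (4 : ℝ) ^ (flatDim L / 2 : ℝ) * Real.exp (-((1 / (4 * sliceConst L)) ^ 2 * r ^ 2 / (4 * (powScale 1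 β) ^ 2))) * fpWeightBar L (powScale 1 β)))) * Real.exp (-stiffGaussExp L t b (chartVec w)) ≤
      ∫ g, coreWeight L ε R₁' g * boFun L χ₀ (frozenProfile L qf rf β) (gaugeTransform g⁻¹ (latPatternChart L (fun _ => false) w)) ∂gaugeMeasure L := by
  set sg := powScale 1 β with hsgdef
  set c := 1 / (4 * sliceConst L) with hcdef
  set E : ℝ := (Fintype.card (Edge 3 L) : ℝ) with hEdef
  set D' := CL * ((4 + 48 * Ksp) * ρ) * (9 * Ksp * ρ) + MT * (9 * Ksp * ρ) ^ 2 with hD'def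
  set X := Rw + 14 * E * ρ ^ 2 + D' with hXdef
  set D := B * r + MT * r ^ 2 with hDdef
  set εq := (96 * t + b) * D * (2 * X + D) with hεqdef
  set εtr := (96 * t + b) * (D' * (2 * X + D') + 72 * E * ρ ^ 3) with hεtrdef
  set Tb := (1 + KD * ((4 + 48 * Ksp) * ρ) ^ 2) * (4 : ℝ) ^ (flatDim L / 2 : ℝ) * Real.exp (-(c ^ 2 * r ^ 2 / (4 * sg ^ 2))) * fpWeightBar L sg with hTbdef
  have hCχ0 : 0 ≤ Cχ := (hχ0 1).trans (hCχ 1)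
  set V := latPatternChart L (fun _ => false) w with hV
  -- the representative and the transfer
  obtain ⟨c₀, ξ', p, hrep, hξ', hslice, hsc, hpn⟩ := chartPoint_slice_rep (L := L) hKsp hSP hρ0 hρ5 hρε hρK hR50 hw
  obtain ⟨-, hqtr⟩ := chart_rep_transfer (L := L) ht hb hKsp hρ0 hρ5 hw hrep hξ' hpn hMT hT hCL hLip hB0 hB h1 h2 h3 h4 h5
  have hx'le := norm_rep_le_refined (L := L) hKsp hρ0 hρ5 hw hrep hξ' hpn hslice hMT hT hCL hLip h1 h2 h4 h5
  obtain ⟨hVfat, hpfat, havg⟩ := chartPoint_fatTube_data (L := L) (δ := fun b' => K * powScale s b') (ρf := fun b' => M * (K * powScale s b')) hKsp hρ0 hw hδ hρf hrep hsc hρ₁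
  -- step (5): the core-complement part vanishes
  have hGV : ‖(gaugeModes L).starProjection (relLinkVec L (latPatternChart L (fun _ => false) w))‖ ≤ Rw + 14 * Fintype.card (Edge 3 L) * ρ ^ 2 := by
    have e1 : relLinkVec L (latPatternChart L (fun _ => false) w) = chartVec w - (chartVec w - relLinkVec L (latPatternChart L (fun _ => false) w)) := by abel
    rw [e1, map_sub]
    refine (norm_sub_le _ _).trans (add_le_add ((Submodule.norm_starProjection_apply_le _ _).trans hcwR) (norm_proj_chartVec_sub_relLinkVec_le hρ0 hρ5 hw))
  have htail : ∫ g, (coreSet L R₁')ᶜ.indicator (fun g => boFun L χ₀ (frozenProfile L qf rf β) (gaugeTransform g⁻¹ V)) g ∂gaugeMeasure L = 0 := by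
    rw [hV]
    exact integral_coreComplement_eq_zero (L := L) p hMT hT hC (lt_of_le_of_lt hpn h1) (lt_of_le_of_lt hpn h6) (hpn.trans h4) hslice hpfat.1 hrep hξ' h5 ha'3 hboot' hGV
      (boFun_frozenProfile_support (L := L) hbo) hRb3 hRbT hbootb hjump
  rw [← hV] at hVfat havg
  set x' : LinkSpace L := linkEmbed L (p.1 : Edge 3 L → Fin 3 → ℝ) with hx'
  have hpT : ‖p‖ < εT := lt_of_le_of_lt hpn h1
  have hpC : ‖p‖ < εC := lt_of_le_of_lt hpn h6
  have hp40 : ‖p‖ ≤ 1 / 40 := hpn.trans h4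
  have hpB : ‖basedLin L p‖ ≤ B := hB p (lt_of_le_of_lt hpn h3)
  have hpI : ∫ w, Real.exp (-(1 / 4 * ‖laplaceMap L p w‖ ^ 2 / sg ^ 2)) ∂(volume : Measure (NzSite L → Fin 3 → ℝ)) =
      (π * sg ^ 2 / (1 / 4)) ^ (flatDim L / 2 : ℝ) / Real.sqrt (gramDet L p) := hI p (lt_of_le_of_lt hpn h7) (by norm_num) hs1
  have hpx : |gramDet L p / gramDet L 0 - 1| ≤ KD * ((4 + 48 * Ksp) * ρ) ^ 2 :=
    (hD p (lt_of_le_of_lt hpn h8)).trans (mul_le_mul_of_nonneg_left (pow_le_pow_left₀ (norm_nonneg _) hpn 2) hKD)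
  have hCpos := sliceConst_pos L
  have hθp : (MT + 2 * ‖basedLin L p‖) * R₁ * (4 * sliceConst L) ≤ 1 / 4 := by
    have hR10 : 0 ≤ R₁ := hr0.trans hrR
    calc (MT + 2 * ‖basedLin L p‖) * R₁ * (4 * sliceConst L) ≤ (MT + 2 * B) * R₁ * (4 * sliceConst L) := by gcongr
      _ ≤ 1 / 4 := hθ
  -- sizes
  have hXx : ‖x'‖ ≤ X := hx'le.trans (by rw [hXdef, hD'def, hEdef]; linarith [hcwR])
  have hX0 : 0 ≤ X := (norm_nonneg _).trans hXx
  have h96 : 0 ≤ 96 * t + b := by positivity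
  set Dp : ℝ := ‖basedLin L p‖ * r + MT * r ^ 2 with hDp
  have hDp0 : 0 ≤ Dp := by positivity
  have hDpD : Dp ≤ D := by
    rw [hDp, hDdef]; have := mul_le_mul_of_nonneg_right hpB hr0; linarith
  -- the indicator facts at the representative
  have hind : ∀ w' : NzSite L → Fin 3 → ℝ, ‖w'‖ ≤ r → gaugeTransform (basedExt L fun y => gnoPoint (w' y)) (tubePt L p) ∈ orthoTubeSet L ∧
      χlo ≤ χ₀ (slowMean L (gaugeTransform (basedExt L fun y => gnoPoint (w' y)) (tubePt L p))) ∧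
      ‖relLinkVec L (gaugeTransform (basedExt L fun y => gnoPoint (w' y)) (tubePt L p))‖ ≤ rf β := by
    intro w' hw'
    obtain ⟨_, htube, -, -, hrel⟩ := slice_core_indicator_facts (L := L) (δ := fun b' => K * powScale s b') (ρ := fun b' => M * (K * powScale s b')) p hMT hT hpT hp40
      hpfat hr0 (lt_of_le_of_lt hrR hR1T) (hrR.trans hR1) hcore hρ4 hw'
    obtain ⟨hsm, hS1⟩ := slowMean_slice_core_sharp (L := L) p hp40 hr40 hw'
    -- weaken `‖p‖ ≤ (4+48K)ρ` inside the sharp bound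
    have hrp : 2 * r * ‖p‖ ≤ 2 * r * ((4 + 48 * Ksp) * ρ) := mul_le_mul_of_nonneg_left hpn (by positivity)
    have hmono : 2 * ‖p‖ + 6 * (40 * (4 * r ^ 2 + 2 * r * ‖p‖) + 3 * r) ≤
        2 * ((4 + 48 * Ksp) * ρ) + 6 * (40 * (4 * r ^ 2 + 2 * r * ((4 + 48 * Ksp) * ρ)) + 3 * r) := by linarith
    have ha0 : 0 ≤ 2 * ‖p‖ + 6 * (40 * (4 * r ^ 2 + 2 * r * ‖p‖) + 3 * r) := by positivity
    have hpow := pow_le_pow_left₀ ha0 hmono 4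
    refine ⟨htube, hχlo _ (fun k => (hsm k).trans hmono) (hS1.trans (by linarith)), hrel.trans ?_⟩
    rw [← hx']
    have e1 : ‖basedLin L p‖ * r + MT * r ^ 2 ≤ D := hDpD
    calc ‖x'‖ + (‖basedLin L p‖ * r + MT * r ^ 2) ≤ X + D := add_le_add hXx e1
      _ ≤ rf β := by rw [hXdef, hDdef, hD'def, hEdef]; exact hrf
  -- the orbit lower bound at `V`
  obtain ⟨hlo, -⟩ := localisedAvg_orbit_bounds (L := L) hL hs1 p hMT hεT hT hC hpT hpC hp40 hslice hpfat hr0 hrR hR1 hR1T hcore hsupp hθp ht hb hqfm hqf0 hqfinv hqf rf hχm hχ0 hCχ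
    hχinv hbo ε R₁' hZ0 hZ hχlo0 hind havg
  rw [← hx'] at hlo
  -- `ε_q(p) ≤ ε_q`, `ε_tr(p) ≤ ε_tr`
  have hεqp : (96 * t + b) * Dp * (2 * ‖x'‖ + Dp) ≤ εq := by
    rw [hεqdef]
    have := mul_le_mul hDpD (by linarith : 2 * ‖x'‖ + Dp ≤ 2 * X + D) (by positivity) (hDp0.trans hDpD)
    calc (96 * t + b) * Dp * (2 * ‖x'‖ + Dp) = (96 * t + b) * (Dp * (2 * ‖x'‖ + Dp)) := by ring
      _ ≤ (96 * t + b) * (D * (2 * X + D)) := mul_le_mul_of_nonneg_left this h96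
      _ = _ := by ring
  have hD'0 : 0 ≤ D' := by positivity
  have hin : D' * (2 * ‖x'‖ + D') + 72 * (Fintype.card (Edge 3 L) : ℝ) * ρ ^ 3 ≤ D' * (2 * X + D') + 72 * E * ρ ^ 3 := by
    have := mul_le_mul_of_nonneg_left (by linarith [hXx] : 2 * ‖x'‖ + D' ≤ 2 * X + D') hD'0
    rw [hEdef]; linarith
  have hεtrp : (96 * t + b) * (D' * (2 * ‖x'‖ + D') + 72 * Fintype.card (Edge 3 L) * ρ ^ 3) ≤ εtr := by
    rw [hεtrdef]; exact mul_le_mul_of_nonneg_left hin h96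
  have hq := hqtr.trans hεtrp
  obtain ⟨-, hexp2⟩ := exp_neg_transfer hq   -- `e^{−ε_tr} e^{−q(chartVec w)} ≤ e^{−q(x*)}`
  have hNV : Nlo ≤ gaugeAvg (recordChi L s K M β) V := hN V hVfat
  have hTail := laplace_tail_le_fpWeightBar (L := L) hs1 p hpI hpx h9 (c ^ 2 * r ^ 2 / (4 * sg ^ 2))
  -- assemble: main term
  have hNTb : Tb ≤ Nlo := by rw [hTbdef, hcdef, hsgdef]; exact hNT
  have step1 : χlo * Real.exp (-(εq + εtr)) * (Nlo - Tb) * Real.exp (-stiffGaussExp L t b (chartVec w)) ≤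
      χlo * Real.exp (-((96 * t + b) * Dp * (2 * ‖x'‖ + Dp))) * Real.exp (-stiffGaussExp L t b x') *
        (gaugeAvg (recordChi L s K M β) V - ((2 * π ^ 2)⁻¹) ^ Fintype.card (NzSite L) * (Real.exp (-(c ^ 2 * r ^ 2 / (4 * sg ^ 2))) *
          ∫ w, Real.exp (-(1 / 4 * ‖laplaceMap L p w‖ ^ 2 / sg ^ 2)) ∂(volume : Measure (NzSite L → Fin 3 → ℝ)))) := by
    have e1 : Real.exp (-εq) ≤ Real.exp (-((96 * t + b) * Dp * (2 * ‖x'‖ + Dp))) := Real.exp_le_exp.2 (by linarith)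
    have e2 : Real.exp (-(εq + εtr)) * Real.exp (-stiffGaussExp L t b (chartVec w)) ≤ Real.exp (-((96 * t + b) * Dp * (2 * ‖x'‖ + Dp))) * Real.exp (-stiffGaussExp L t b x') := by
      calc Real.exp (-(εq + εtr)) * Real.exp (-stiffGaussExp L t b (chartVec w)) = Real.exp (-εq) * (Real.exp (-εtr) * Real.exp (-stiffGaussExp L t b (chartVec w))) := by
            rw [neg_add, Real.exp_add]; ring
        _ ≤ Real.exp (-((96 * t + b) * Dp * (2 * ‖x'‖ + Dp))) * Real.exp (-stiffGaussExp L t b x') := mul_le_mul e1 hexp2 (by positivity) (Real.exp_pos _).le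
    have e3 : Nlo - Tb ≤ gaugeAvg (recordChi L s K M β) V - ((2 * π ^ 2)⁻¹) ^ Fintype.card (NzSite L) * (Real.exp (-(c ^ 2 * r ^ 2 / (4 * sg ^ 2))) *
          ∫ w, Real.exp (-(1 / 4 * ‖laplaceMap L p w‖ ^ 2 / sg ^ 2)) ∂(volume : Measure (NzSite L → Fin 3 → ℝ))) := by
      have : ((2 * π ^ 2)⁻¹) ^ Fintype.card (NzSite L) * (Real.exp (-(c ^ 2 * r ^ 2 / (4 * sg ^ 2))) *
          ∫ w, Real.exp (-(1 / 4 * ‖laplaceMap L p w‖ ^ 2 / sg ^ 2)) ∂(volume : Measure (NzSite L → Fin 3 → ℝ))) ≤ Tb := hTail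
      linarith
    have e4 := mul_le_mul e2 e3 (by linarith) (by positivity)
    calc _ = χlo * ((Real.exp (-(εq + εtr)) * Real.exp (-stiffGaussExp L t b (chartVec w))) * (Nlo - Tb)) := by ring
      _ ≤ χlo * ((Real.exp (-((96 * t + b) * Dp * (2 * ‖x'‖ + Dp))) * Real.exp (-stiffGaussExp L t b x')) *
          (gaugeAvg (recordChi L s K M β) V - ((2 * π ^ 2)⁻¹) ^ Fintype.card (NzSite L) * (Real.exp (-(c ^ 2 * r ^ 2 / (4 * sg ^ 2))) *
            ∫ w, Real.exp (-(1 / 4 * ‖laplaceMap L p w‖ ^ 2 / sg ^ 2)) ∂(volume : Measure (NzSite L → Fin 3 → ℝ))))) := mul_le_mul_of_nonneg_left e4 hχlo0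
      _ = _ := by ring
  -- assemble
  calc _ = Z * (χlo * Real.exp (-(εq + εtr)) * (Nlo - Tb) * Real.exp (-stiffGaussExp L t b (chartVec w)) - 0) := by ring
    _ ≤ Z * (χlo * Real.exp (-((96 * t + b) * Dp * (2 * ‖x'‖ + Dp))) * Real.exp (-stiffGaussExp L t b x') *
        (gaugeAvg (recordChi L s K M β) V - ((2 * π ^ 2)⁻¹) ^ Fintype.card (NzSite L) * (Real.exp (-(c ^ 2 * r ^ 2 / (4 * sg ^ 2))) *
          ∫ w, Real.exp (-(1 / 4 * ‖laplaceMap L p w‖ ^ 2 / sg ^ 2)) ∂(volume : Measure (NzSite L → Fin 3 → ℝ)))) -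
        ∫ g, (coreSet L R₁')ᶜ.indicator (fun g => boFun L χ₀ (frozenProfile L qf rf β) (gaugeTransform g⁻¹ V)) g ∂gaugeMeasure L) := by
        rw [htail]; exact mul_le_mul_of_nonneg_left (sub_le_sub_right step1 _) hZ0
    _ ≤ _ := hlo

end Summit.QuantumFields.YangMills.Theorems.FemtoTransferGap.TwoLattice.ConstTube

end
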